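import Mathlib
import Summits.Ventures.HodgeRepro2.T7SupportTwoTorusInvariant
import Summits.Ventures.HodgeRepro2.Tier7.Line3.KappaDataFinLocal
import Summits.Ventures.HodgeRepro2.Tier7.Line3.LevelInvariantOrbital

/-!
# Tier7/Line3/TorusSupport — the two tori of p1's model as SUBGROUPS of `GL₂`, and `InSupport` ⇒ `IsTranslate`
(seat t7-x1, gen 3; STAGE 2 of the joint `arith` — crit-2's record (a) on LevelFactorData p693194, STATUS l. 15678)

LINE 3 (t7-plan-3), version (ii). p1's model (T7SupportTwoTorusInvariant) has the first torus `T_A` = the diagonal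
matrices `diagonal a` with `N(a i) = 1` and the second torus `T_B` = the matrices `t′` acting on the second orthogonal
basis `f` by scalars `b j` with `N(b j) = 1` (`ActsOn f t′ b`); L1-p5's KappaDataFinLocal states the level-`N` support at
`v₁` through `IsTranslate σ f g m := ∃ a b t′, N(a 0) = 1 ∧ N(b 0) = 1 ∧ ActsOn f t′ b ∧ m = diagonal a · g · t′`. x1's
LevelInvariantOrbital / LevelFactorData state it through `InSupport ιA ιB γ₀ K γ := ∃ tA tB, ∃ k ∈ K, γ = ιA(tA)⁻¹ γ₀ k ιB(tB)`
on an abstract group with torus homs. This module builds the tori as GROUPS and proves the implication: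
* `normOne σ : Subgroup Fˣ` (`N(u) = 1`); `diagUnitHom : (Fin 2 → Fˣ) →* GL (Fin 2) F` (diagonal units);
  `torusA σ := Subgroup.pi univ (fun _ => normOne σ)` and `iotaA σ : torusA σ →* GL (Fin 2) F` — the first torus;
* `torusB σ f : Subgroup (GL (Fin 2) F)` = `{t′ | ∃ b, (∀ i, N(b i) = 1) ∧ ActsOn f t′ b}` (closed under products —
  `t′₁ t′₂` acts by `b₁ b₂` — and inverses — `t′⁻¹` acts by `b⁻¹`), `iotaB σ f := (torusB σ f).subtype` — the second torus;
* **`isTranslate_of_inSupport`**: `InSupport (iotaA σ) (iotaB σ f) γ₀ K γ → ∃ k ∈ K, IsTranslate σ f γ (γ₀ · k)` (read in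
  the matrices: `ιA(tA) · γ · ιB(tB)⁻¹ = γ₀ · k`, with `a` the diagonal of `tA` and `t′ = ιB(tB)⁻¹ ∈ T_B`).
So a level-`N` support stated with `InSupport` over the level tower (CongruenceSubgroup.levelTower) yields p5's `hsupp`
clause («some torus translate of `γ` is `γ₀ · k` with `k ≡ 1`») — ONE `arith` serves KappaDataFinLocal's `hcong` and
LevelFactorData's `b`-fields (the joint statement is the next module). DICTIONARY (in words): `F = E_{v₁}`, `σ` its
involution, `f` the local second basis, the real tori = these subgroups. Nothing here is about (N), (P), the real `X`,
or HC_CM; §8(d): NO. Blind lane: Mathlib + the HodgeRepro2 prefix; no sorry; axioms ⊆ {propext, Classical.choice, Quot.sound}.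
-/

namespace Summit.Ventures.HodgeRepro2.Tier7.Line3.TorusSupport

open Matrix Summit.Ventures.HodgeRepro2.T7SupportTwoTorusInvariant
  Summit.Ventures.HodgeRepro2.Tier7.Line3.KappaDataFinLocal
  Summit.Ventures.HodgeRepro2.Tier7.Line3.LevelInvariantOrbital

variable {F : Type*} [Field F] (σ : F →+* F)

/-! ## The norm-one subgroup and the diagonal torus -/

/-- the norm of an inverse. -/
theorem nrm_inv (x : F) : nrm σ x⁻¹ = (nrm σ x)⁻¹ := by
  simp only [nrm, map_inv₀, mul_inv]

/-- **the norm-one subgroup** `N¹ = {u ∈ Fˣ | N(u) = 1}`. -/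
def normOne : Subgroup Fˣ where
  carrier := {u | nrm σ (u : F) = 1}
  one_mem' := by
    show nrm σ ((1 : Fˣ) : F) = 1
    rw [Units.val_one, nrm_one]
  mul_mem' := by
    intro a b ha hb
    show nrm σ ((a * b : Fˣ) : F) = 1
    rw [Units.val_mul, nrm_mul, show nrm σ (a : F) = 1 from ha, show nrm σ (b : F) = 1 from hb, one_mul]
  inv_mem' := by
    intro a ha
    show nrm σ ((a⁻¹ : Fˣ) : F) = 1
    rw [Units.val_inv_eq_inv_val, nrm_inv, show nrm σ (a : F) = 1 from ha, inv_one]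

/-- membership in `normOne`, by definition. -/
theorem mem_normOne (u : Fˣ) : u ∈ normOne σ ↔ nrm σ (u : F) = 1 := Iff.rfl

/-- the diagonal matrix of a vector of units, as an element of `GL (Fin 2) F`. -/
def diagUnit (a : Fin 2 → Fˣ) : GL (Fin 2) F where
  val := diagonal fun i => (a i : F)
  inv := diagonal fun i => ((a i)⁻¹ : Fˣ)
  val_inv := by
    rw [diagonal_mul_diagonal]
    simp
  inv_val := by
    rw [diagonal_mul_diagonal]
    simp

/-- the matrix of `diagUnit a` is the diagonal of `a`. -/
theorem coe_diagUnit (a : Fin 2 → Fˣ) :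
    ((diagUnit a : GL (Fin 2) F) : Matrix (Fin 2) (Fin 2) F) = diagonal fun i => (a i : F) := rfl

/-- `diagUnit` is a group homomorphism. -/
def diagUnitHom : (Fin 2 → Fˣ) →* GL (Fin 2) F where
  toFun := diagUnit
  map_one' := by
    apply Units.ext
    rw [coe_diagUnit, Units.val_one]
    simp [diagonal_one]
  map_mul' := by
    intro a b
    apply Units.ext
    rw [Units.val_mul, coe_diagUnit, coe_diagUnit, coe_diagUnit, diagonal_mul_diagonal]
    simp

/-- **the first torus** `T_A` = norm-one diagonal matrices, as a subgroup of `Fin 2 → Fˣ`. -/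
def torusA : Subgroup (Fin 2 → Fˣ) := Subgroup.pi Set.univ fun _ => normOne σ

/-- the embedding of the first torus into `GL (Fin 2) F`. -/
def iotaA : torusA σ →* GL (Fin 2) F := diagUnitHom.comp (torusA σ).subtype

/-- the matrix of `iotaA σ t` is the diagonal of the entries of `t`. -/
theorem coe_iotaA (t : torusA σ) :
    ((iotaA σ t : GL (Fin 2) F) : Matrix (Fin 2) (Fin 2) F) = diagonal fun i => ((t : Fin 2 → Fˣ) i : F) := rfl

/-- the entries of an element of the first torus have norm one. -/
theorem nrm_iotaA_entry (t : torusA σ) (i : Fin 2) : nrm σ (((t : Fin 2 → Fˣ) i : F)) = 1 :=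
  (Subgroup.mem_pi Set.univ).1 t.2 i (Set.mem_univ i)

/-! ## The second torus -/

variable (f : Fin 2 → Fin 2 → F)

/-- `ActsOn` for the identity. -/
theorem actsOn_one : ActsOn f (1 : Matrix (Fin 2) (Fin 2) F) (fun _ => (1 : F)) := by
  intro j
  simp

/-- `ActsOn` for a product. -/
theorem actsOn_mul {t₁ t₂ : Matrix (Fin 2) (Fin 2) F} {b₁ b₂ : Fin 2 → F} (h₁ : ActsOn f t₁ b₁)
    (h₂ : ActsOn f t₂ b₂) : ActsOn f (t₁ * t₂) (fun j => b₁ j * b₂ j) := by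
  intro j
  rw [← mulVec_mulVec, h₂ j, mulVec_smul, h₁ j, smul_smul, mul_comm]

/-- a scalar of norm one is non-zero. -/
theorem ne_zero_of_nrm_eq_one {x : F} (hx : nrm σ x = 1) : x ≠ 0 := by
  rintro rfl
  simp [nrm] at hx

/-- `ActsOn` for the inverse of a unit. -/
theorem actsOn_inv {t : GL (Fin 2) F} {b : Fin 2 → F} (hb : ∀ j, b j ≠ 0)
    (h : ActsOn f (t : Matrix (Fin 2) (Fin 2) F) b) :
    ActsOn f ((t⁻¹ : GL (Fin 2) F) : Matrix (Fin 2) (Fin 2) F) (fun j => (b j)⁻¹) := by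
  intro j
  have h1 : ((t⁻¹ : GL (Fin 2) F) : Matrix (Fin 2) (Fin 2) F) * (t : Matrix (Fin 2) (Fin 2) F) = 1 :=
    Units.inv_mul t
  have h2 : f j = b j • (((t⁻¹ : GL (Fin 2) F) : Matrix (Fin 2) (Fin 2) F) *ᵥ f j) := by
    rw [← mulVec_smul, ← h j, mulVec_mulVec, h1, one_mulVec]
  calc ((t⁻¹ : GL (Fin 2) F) : Matrix (Fin 2) (Fin 2) F) *ᵥ f j
      = (b j)⁻¹ • (b j • (((t⁻¹ : GL (Fin 2) F) : Matrix (Fin 2) (Fin 2) F) *ᵥ f j)) := by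
        rw [inv_smul_smul₀ (hb j)]
    _ = (b j)⁻¹ • f j := by rw [← h2]

/-- **the second torus** `T_B` = the units acting on the basis `f` by norm-one scalars. -/
def torusB : Subgroup (GL (Fin 2) F) where
  carrier := {t | ∃ b : Fin 2 → F, (∀ i, nrm σ (b i) = 1) ∧ ActsOn f (t : Matrix (Fin 2) (Fin 2) F) b}
  one_mem' := ⟨fun _ => 1, fun _ => nrm_one σ, by rw [Units.val_one]; exact actsOn_one f⟩
  mul_mem' := by
    rintro t₁ t₂ ⟨b₁, hb₁, h₁⟩ ⟨b₂, hb₂, h₂⟩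
    refine ⟨fun j => b₁ j * b₂ j, fun i => by rw [nrm_mul, hb₁ i, hb₂ i, one_mul], ?_⟩
    rw [Units.val_mul]
    exact actsOn_mul f h₁ h₂
  inv_mem' := by
    rintro t ⟨b, hb, h⟩
    refine ⟨fun j => (b j)⁻¹, fun i => by rw [nrm_inv, hb i, inv_one], ?_⟩
    exact actsOn_inv f (fun j => ne_zero_of_nrm_eq_one σ (hb j)) h

/-- membership in the second torus, by definition. -/
theorem mem_torusB (t : GL (Fin 2) F) :
    t ∈ torusB σ f ↔ ∃ b : Fin 2 → F, (∀ i, nrm σ (b i) = 1) ∧ ActsOn f (t : Matrix (Fin 2) (Fin 2) F) b :=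
  Iff.rfl

/-- the embedding of the second torus into `GL (Fin 2) F`. -/
def iotaB : torusB σ f →* GL (Fin 2) F := (torusB σ f).subtype

/-- the matrix of `iotaB σ f t` is the matrix of `t`. -/
theorem coe_iotaB (t : torusB σ f) :
    ((iotaB σ f t : GL (Fin 2) F) : Matrix (Fin 2) (Fin 2) F) = ((t : GL (Fin 2) F) : Matrix (Fin 2) (Fin 2) F) :=
  rfl

/-! ## `InSupport` ⇒ `IsTranslate` -/

/-- **the support condition in the group implies p5's torus-translate shape**: if
`γ = ι_A(t_A)⁻¹ γ₀ k ι_B(t_B)` with `k ∈ K`, then `diagonal a · γ · t′ = γ₀ · k` with `a` the diagonal of `t_A`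
(norm one) and `t′ = ι_B(t_B)⁻¹ ∈ T_B` — `IsTranslate σ f γ (γ₀ k)`. -/
theorem isTranslate_of_inSupport (K : Subgroup (GL (Fin 2) F)) (γ₀ γ : GL (Fin 2) F)
    (h : InSupport (iotaA σ) (iotaB σ f) γ₀ K γ) :
    ∃ k ∈ K, IsTranslate σ f (γ : Matrix (Fin 2) (Fin 2) F) ((γ₀ * k : GL (Fin 2) F) : Matrix (Fin 2) (Fin 2) F) := by
  obtain ⟨tA, tB, k, hk, rfl⟩ := h
  refine ⟨k, hk, ?_⟩
  obtain ⟨b, hb, hact⟩ := (mem_torusB σ f _).1 (tB⁻¹).2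
  refine ⟨fun i => ((tA : Fin 2 → Fˣ) i : F), b, (((tB⁻¹ : torusB σ f) : GL (Fin 2) F) : Matrix (Fin 2) (Fin 2) F),
    nrm_iotaA_entry σ tA 0, hb 0, hact, ?_⟩
  have hgroup : (iotaA σ tA) * ((iotaA σ tA)⁻¹ * γ₀ * k * iotaB σ f tB) * (iotaB σ f tB)⁻¹ = γ₀ * k := by
    group
  have hB : ((iotaB σ f tB)⁻¹ : GL (Fin 2) F) = ((tB⁻¹ : torusB σ f) : GL (Fin 2) F) := rfl
  calc ((γ₀ * k : GL (Fin 2) F) : Matrix (Fin 2) (Fin 2) F)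
      = (((iotaA σ tA) * ((iotaA σ tA)⁻¹ * γ₀ * k * iotaB σ f tB) * (iotaB σ f tB)⁻¹ : GL (Fin 2) F) :
          Matrix (Fin 2) (Fin 2) F) := by rw [hgroup]
    _ = diagonal (fun i => ((tA : Fin 2 → Fˣ) i : F)) *
          (((iotaA σ tA)⁻¹ * γ₀ * k * iotaB σ f tB : GL (Fin 2) F) : Matrix (Fin 2) (Fin 2) F) *
          (((tB⁻¹ : torusB σ f) : GL (Fin 2) F) : Matrix (Fin 2) (Fin 2) F) := by
        rw [Units.val_mul, Units.val_mul, coe_iotaA, hB]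

end Summit.Ventures.HodgeRepro2.Tier7.Line3.TorusSupport
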